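import Literature.Computability.QuantumComplexity.SampleQueryAccess
import HarnessLib

/-!
# The Kerenidis–Prakash tree: the data structure behind ℓ²-norm sampling access

Kerenidis, Prakash, *Quantum Recommendation Systems*, ITCS 2017 (LIPIcs 67, 49; arXiv:1603.08675),
**§5.1 "The data structure", Theorem 5.1** (restated and proved as **Theorem 7.1** of the arXiv
text, §7 = Appendix A, Theorem A.1 of the proceedings version), and Tang, *A quantum-inspired
classical algorithm for recommendation systems*, STOC 2019 (arXiv:1807.04271), **§3 Lemma 3.1**:

> **Lemma 3.1 (Tang).** There exists a data structure storing a vector `v ∈ ℝⁿ` with `w` nonzero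
> entries in `O(w log n)` space, supporting the following operations: reading and updating an
> entry of `v` in `O(log n)` time; finding `‖v‖²` in `O(1)` time; sampling from `𝒟_v` in
> `O(log n)` time.
>
> (KP, proof of Theorem 7.1) "An internal node `v` of `B_i` stores the sum of the values of all
> leaves in the subtree rooted at `v` … Hence, the value stored at the root is `‖A_i‖²`. When a new
> entry arrives, all the nodes on the path from that leaf to the tree root are also updated. …
> The amplitude stored at an internal node of `B_i` at depth `t` corresponding to `k ∈ {0,1}^t` is
> `B_{i,k} := ∑_{j ∈ [n], j_{1:t} = k} A_{ij}²` … Note that `B_{i,k}` is the probability of observing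
> outcome `k` if the first `t` bits of `|A_i⟩` are measured in the standard basis."  Tang (§3):
> "this … is the data structure Kerenidis and Prakash use to prepare arbitrary quantum states".

This is the object that makes "sampling and query access" (`SampleQueryAccess.lean`, CGLLTW
Defs. 2.5–2.9) an `O(log n)`-overhead assumption on classical data, and — read in the other
direction — the reason a QRAM/KP-tree state-preparation assumption is matched by an `ℓ²`-sampling
assumption (Tang 2019 §1: "the data structure used to satisfy state preparation assumptions can
also satisfy `ℓ²`-norm sampling assumptions").  Formalized here for `n = 2^d` leaves (one vector;
the matrix version, Tang Prop. 3.2 / KP Thm 5.1 — one such tree per row plus one for the row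
norms — is the final section `matrix`) as statements about the stored numbers — running times are
represented by node counts:

* `prefixOf t j = j_{1:t}` (the depth-`t` ancestor of leaf `j`), `nodeWeight v t k = B_k =
  ∑_{j_{1:t} = k} v_j²`;
* the root stores `‖v‖²` (`nodeWeight_root`; "finding `‖v‖²` in `O(1)`"), the leaves store `v_j²`
  (`nodeWeight_leaf`), every internal node is the sum of its two children
  (`nodeWeight_eq_add_children`) — the tree invariant;
* SAMPLING: the classical descent that moves from node `k` to child `c` with probability `B_c/B_k`
  (the branch probabilities sum to `1`, `branchProb_add` — the KP rotation is norm-preserving)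
  reaches leaf `j` with probability `leafProb v j = ∏_{t<d} B_{j_{1:t+1}}/B_{j_{1:t}}`, and this
  telescopes to `𝒟_v(j) = v_j²/‖v‖²` (`leafProb_eq_lengthSqDist`, `sum_leafProb`; `d = log₂ n`
  coins per sample — "sampling from `𝒟_v` in `O(log n)` time");
* UPDATE: changing `v_j` leaves every node off the root-to-`j` path unchanged
  (`nodeWeight_update_of_ne`), changes each path node by `− v_j² + c²` (`nodeWeight_update_path`),
  and the path has `d + 1` nodes (`card_path`) — "we need to update `log(n)` nodes".
* MATRIX (Tang Prop. 3.2, `m = 2^e` rows): `rowNormVec A = Ã` (`Ã_i = ‖A_i‖`); the row-norm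
  tree's root is `‖A‖_F²` (`nodeWeight_rowNormVec_root`), its leaves `Ã_i²` are the roots of the
  row trees (`rowNormVec_sq`); descending it samples `𝒟_Ã = rowDist A` (`leafProb_rowNormVec`),
  then row `i`'s tree samples `𝒟_{A_i}` (`leafProb_row`), jointly `(i,j)` w.p. `A_{ij}²/‖A‖_F²`
  (`leafProb_rowNormVec_mul_leafProb_row`, summing to `1`); an entry update `A_{ij} ↦ c`
  (`updateEntry`) touches row `i`'s tree as in Lemma 3.1 and the row-norm tree along one path,
  each path node by `−A_{ij}² + c²` (`rowNormVec_updateEntry`,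
  `nodeWeight_rowNormVec_updateEntry_of_ne/_path`) — `(d+1)+(e+1) = log₂(mn)+2` nodes.

Conventions.  Real entries (`Fin (2^d) → ℝ`, the vocabulary of `SampleQueryAccess.lean`; KP store
`A_{ij}²` and the sign separately — the sign plays no role in the weights); general `n` is the case
of a vector padded with zeros to the next power of two (zero leaves have weight `0` and are never
sampled).  Division junk values: a zero node weight on the path forces the leaf weight to be `0`,
and Lean's `x/0 = 0` then gives the correct probability `0` (`leafProb_eq_lengthSqDist` needs only
`v ≠ 0`).  Space bounds (`O(w log n)`) and address bookkeeping are not modelled.  No named facts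
are introduced; everything stated is proved.

## References
* [KerenidisPrakash2017] I. Kerenidis, A. Prakash, ITCS 2017, LIPIcs 67, 49:1–49:21,
  doi:10.4230/LIPIcs.ITCS.2017.49 (arXiv:1603.08675; numbering of the arXiv text held as
  `paper:arxiv-1603.08675`: §5.1 Theorem 5.1, §7 Theorem 7.1 and its proof).
* [TangEwin2019] E. Tang, STOC 2019, 217–228, doi:10.1145/3313276.3316310 (arXiv:1807.04271),
  §3 Lemma 3.1, Proposition 3.2, Fig. 1.
-/

noncomputable section

namespace Literature.Computability.QuantumComplexity

namespace SampleQuery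

namespace KPTree

open Finset

variable {d : ℕ}

/-- The first `t` bits `j_{1:t}` of a `d`-bit leaf index `j ∈ [2^d]`, read as a number `< 2^t`:
`⌊j / 2^{d−t}⌋` — the address of the depth-`t` ancestor of leaf `j`.
[cite: KerenidisPrakash2017, §7 proof of Theorem 7.1 ("`j_{1:t}` denotes the first `t` bits in the
binary representation for `j`")] -/
def prefixOf (t : ℕ) (j : Fin (2 ^ d)) : ℕ := (j : ℕ) / 2 ^ (d - t)

/-- The value stored at the internal node of depth `t` with address `k ∈ {0,1}^t`:
`B_k = ∑_{j : j_{1:t} = k} v_j²`, "the sum of the square amplitudes of the entries in the subtree".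
[cite: KerenidisPrakash2017, §7 proof of Theorem 7.1 (display `B_{i,k} := ∑_{j ∈ [n], j_{1:t}=k} A_{ij}²`)];
[cite: TangEwin2019, §3 Lemma 3.1 and Fig. 1 (the BST storing `v`)] -/
def nodeWeight (v : Fin (2 ^ d) → ℝ) (t k : ℕ) : ℝ :=
  ∑ j ∈ univ.filter (fun j : Fin (2 ^ d) => prefixOf t j = k), v j ^ 2

/-- Node values are sums of squares, hence nonnegative. [cite: KerenidisPrakash2017, §7 proof of
Theorem 7.1] -/
theorem nodeWeight_nonneg (v : Fin (2 ^ d) → ℝ) (t k : ℕ) : 0 ≤ nodeWeight v t k :=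
  sum_nonneg fun j _ => sq_nonneg (v j)

/-- Every leaf hangs below the root: `j_{1:0} = 0`. [cite: KerenidisPrakash2017, §7 proof of
Theorem 7.1] -/
theorem prefixOf_zero (j : Fin (2 ^ d)) : prefixOf 0 j = 0 := by
  unfold prefixOf
  rw [Nat.sub_zero]
  exact Nat.div_eq_of_lt j.isLt

/-- At depth `d` the address is the leaf index itself: `j_{1:d} = j`.
[cite: KerenidisPrakash2017, §7 proof of Theorem 7.1] -/
theorem prefixOf_self (j : Fin (2 ^ d)) : prefixOf d j = j := by
  simp [prefixOf]

/-- Parent address = child address with the last bit dropped: `j_{1:t} = ⌊j_{1:t+1}/2⌋` (`t < d`).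
[cite: KerenidisPrakash2017, §7 proof of Theorem 7.1 (children `k0`, `k1` of node `k`)] -/
theorem prefixOf_eq_div_two {t : ℕ} (ht : t < d) (j : Fin (2 ^ d)) :
    prefixOf t j = prefixOf (t + 1) j / 2 := by
  unfold prefixOf
  rw [Nat.div_div_eq_div_mul, ← pow_succ]
  congr 2
  omega

/-- **The root stores `‖v‖²`** ("Hence, the value stored at the root is `‖A_i‖²`"; Tang: "Finding
`‖v‖²` in `O(1)` time"). [cite: KerenidisPrakash2017, §7 proof of Theorem 7.1];
[cite: TangEwin2019, §3 Lemma 3.1 (second operation)] -/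
theorem nodeWeight_root (v : Fin (2 ^ d) → ℝ) : nodeWeight v 0 0 = normSq v := by
  unfold nodeWeight normSq
  refine sum_congr ?_ fun _ _ => rfl
  ext j
  simp [prefixOf_zero]

/-- **The leaves store `v_j²`** ("The leaf stores the value `A_{ij}²` as well as the sign of
`A_{ij}`"). [cite: KerenidisPrakash2017, §7 proof of Theorem 7.1] -/
theorem nodeWeight_leaf (v : Fin (2 ^ d) → ℝ) (j : Fin (2 ^ d)) :
    nodeWeight v d (j : ℕ) = v j ^ 2 := by
  unfold nodeWeight
  have : (univ.filter fun j' : Fin (2 ^ d) => prefixOf d j' = (j : ℕ)) = {j} := by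
    ext j'
    simp [prefixOf_self, Fin.ext_iff]
  rw [this, sum_singleton]

/-- **An internal node is the sum of its two children**: `B_k = B_{k0} + B_{k1}` (`t < d`) — the
invariant maintained by the insertion/update procedure ("all the nodes on the path from that leaf
to the tree root are also updated"). [cite: KerenidisPrakash2017, §7 proof of Theorem 7.1];
[cite: TangEwin2019, §3 Fig. 1] -/
theorem nodeWeight_eq_add_children (v : Fin (2 ^ d) → ℝ) {t : ℕ} (ht : t < d) (k : ℕ) :
    nodeWeight v t k = nodeWeight v (t + 1) (2 * k) + nodeWeight v (t + 1) (2 * k + 1) := by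
  unfold nodeWeight
  rw [sum_filter, sum_filter, sum_filter, ← sum_add_distrib]
  refine sum_congr rfl fun j _ => ?_
  rw [prefixOf_eq_div_two ht j]
  generalize prefixOf (t + 1) j = m
  by_cases h0 : m = 2 * k
  · have h1 : m ≠ 2 * k + 1 := by omega
    have h2 : m / 2 = k := by omega
    rw [if_pos h2, if_pos h0, if_neg h1, add_zero]
  · by_cases h1 : m = 2 * k + 1
    · have h2 : m / 2 = k := by omega
      rw [if_pos h2, if_neg h0, if_pos h1, zero_add]
    · have h2 : m / 2 ≠ k := by omega
      rw [if_neg h2, if_neg h0, if_neg h1, add_zero]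

/-- Weights do not increase along a root-to-leaf path: `B_{j_{1:t+1}} ≤ B_{j_{1:t}}`.
[cite: KerenidisPrakash2017, §7 proof of Theorem 7.1] -/
theorem nodeWeight_path_succ_le (v : Fin (2 ^ d) → ℝ) {t : ℕ} (ht : t < d) (j : Fin (2 ^ d)) :
    nodeWeight v (t + 1) (prefixOf (t + 1) j) ≤ nodeWeight v t (prefixOf t j) := by
  rw [nodeWeight_eq_add_children v ht (prefixOf t j)]
  have hcases : prefixOf (t + 1) j = 2 * prefixOf t j ∨
      prefixOf (t + 1) j = 2 * prefixOf t j + 1 := by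
    have := prefixOf_eq_div_two ht j
    omega
  rcases hcases with h | h
  · rw [← h]
    exact le_add_of_nonneg_right (nodeWeight_nonneg v _ _)
  · rw [← h]
    exact le_add_of_nonneg_left (nodeWeight_nonneg v _ _)

/-- **The coin at a node is a genuine Bernoulli trial**: at a node of positive weight the two branch
probabilities `B_{k0}/B_k`, `B_{k1}/B_k` sum to `1` (the conditional rotation
`|k⟩|0⟩ ↦ |k⟩(√B_{k0}|0⟩ + √B_{k1}|1⟩)/√B_k` is norm-preserving).
[cite: KerenidisPrakash2017, §7 proof of Theorem 7.1 (the displayed rotation)];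
[cite: TangEwin2019, §3 Lemma 3.1 (third operation)] -/
theorem branchProb_add {v : Fin (2 ^ d) → ℝ} {t : ℕ} (ht : t < d) {k : ℕ}
    (hk : nodeWeight v t k ≠ 0) :
    nodeWeight v (t + 1) (2 * k) / nodeWeight v t k
      + nodeWeight v (t + 1) (2 * k + 1) / nodeWeight v t k = 1 := by
  rw [← add_div, ← nodeWeight_eq_add_children v ht k, div_self hk]

/-- The probability that the classical descent — at each node of the path go to the child `c` with
probability `B_c/B_{parent}` — outputs leaf `j`: the product of the `d = log₂ n` branch
probabilities along the root-to-`j` path.  (This is the measurement statistics of the state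
prepared by the `⌈log n⌉` conditional rotations, read classically: Tang, "Sampling from `𝒟_v` in
`O(log n)` time".) [cite: TangEwin2019, §3 Lemma 3.1 (third operation) and Fig. 1];
[cite: KerenidisPrakash2017, §7 proof of Theorem 7.1 ("`B_{i,k}` is the probability of observing
outcome `k` if the first `t` bits of `|A_i⟩` are measured in the standard basis")] -/
def leafProb (v : Fin (2 ^ d) → ℝ) (j : Fin (2 ^ d)) : ℝ :=
  ∏ t ∈ range d, nodeWeight v (t + 1) (prefixOf (t + 1) j) / nodeWeight v t (prefixOf t j)

/-- Telescoping of a product of successive ratios of a non-increasing nonnegative sequence with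
`f 0 ≠ 0`; a vanishing denominator forces every later term, and the right-hand side, to vanish, so
Lean's `x/0 = 0` is harmless. [folklore] -/
private theorem prod_range_succ_div_eq (f : ℕ → ℝ) (h0 : f 0 ≠ 0) (hnn : ∀ t, 0 ≤ f t)
    (hmono : ∀ t, f (t + 1) ≤ f t) (d : ℕ) :
    ∏ t ∈ range d, f (t + 1) / f t = f d / f 0 := by
  induction d with
  | zero => simp [div_self h0]
  | succ d ih =>
      rw [prod_range_succ, ih]
      by_cases hd : f d = 0
      · have hd1 : f (d + 1) = 0 := le_antisymm (hd ▸ hmono d) (hnn _)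
        simp [hd, hd1]
      · field_simp

/-- **Lemma 3.1 / Theorem 5.1, sampling**: descending the tree with the branch coins outputs leaf `j`
with probability exactly `𝒟_v(j) = v_j²/‖v‖²` (`v ≠ 0`): the `d` ratios telescope from the root
value `‖v‖²` to the leaf value `v_j²`. [cite: TangEwin2019, §3 Lemma 3.1 ("Sampling from `𝒟_v`
in `O(log n)` time")]; [cite: KerenidisPrakash2017, §5.1 Theorem 5.1 / §7 Theorem 7.1 and its proof] -/
theorem leafProb_eq_lengthSqDist {v : Fin (2 ^ d) → ℝ} (hv : v ≠ 0) (j : Fin (2 ^ d)) :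
    leafProb v j = lengthSqDist v j := by
  unfold leafProb lengthSqDist
  -- the path weights, extended constantly beyond depth d
  set f : ℕ → ℝ := fun t => nodeWeight v (min t d) (prefixOf (min t d) j) with hf
  have hf0 : f 0 = normSq v := by simp [hf, prefixOf_zero, nodeWeight_root]
  have hfd : f d = v j ^ 2 := by simp [hf, prefixOf_self, nodeWeight_leaf]
  have hprod : ∏ t ∈ range d,
      nodeWeight v (t + 1) (prefixOf (t + 1) j) / nodeWeight v t (prefixOf t j)
      = ∏ t ∈ range d, f (t + 1) / f t := by
    refine prod_congr rfl fun t ht => ?_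
    have ht' : t < d := mem_range.1 ht
    simp [hf, Nat.min_eq_left ht'.le, Nat.min_eq_left (Nat.succ_le_of_lt ht')]
  rw [hprod, prod_range_succ_div_eq f ?_ ?_ ?_ d, hfd, hf0]
  · rw [hf0]; exact (normSq_pos hv).ne'
  · intro t
    exact nodeWeight_nonneg v _ _
  · intro t
    by_cases h1 : t + 1 ≤ d
    · have e1 : min (t + 1) d = t + 1 := Nat.min_eq_left h1
      have e0 : min t d = t := Nat.min_eq_left (by omega)
      simp only [hf, e1, e0]
      exact nodeWeight_path_succ_le v (by omega) j
    · have e1 : min (t + 1) d = d := Nat.min_eq_right (by omega)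
      have e0 : min t d = d := Nat.min_eq_right (by omega)
      simp only [hf, e1, e0, le_refl]

/-- Hence the descent is a sampler for `𝒟_v`: its leaf probabilities sum to `1`.
[cite: TangEwin2019, §3 Lemma 3.1] -/
theorem sum_leafProb {v : Fin (2 ^ d) → ℝ} (hv : v ≠ 0) : ∑ j, leafProb v j = 1 := by
  simp only [leafProb_eq_lengthSqDist hv]
  exact sum_lengthSqDist hv

/-- **Update locality**: changing the entry `v_j` changes the node `(t,k)` only if it lies on the
root-to-`j` path (`k = j_{1:t}`) — so an update touches the `d + 1 = log₂ n + 1` path nodes and no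
other of the `2n − 1` ("For each entry added to the tree, we need to update `log(n)` nodes"; Tang:
"Reading and updating an entry of `v` in `O(log n)` time").
[cite: KerenidisPrakash2017, §5.1 (text after Theorem 5.1) and §7 proof of Theorem 7.1];
[cite: TangEwin2019, §3 Lemma 3.1 (first operation)] -/
theorem nodeWeight_update_of_ne (v : Fin (2 ^ d) → ℝ) (j : Fin (2 ^ d)) (c : ℝ) {t k : ℕ}
    (hk : k ≠ prefixOf t j) : nodeWeight (Function.update v j c) t k = nodeWeight v t k := by
  unfold nodeWeight
  refine sum_congr rfl fun j' hj' => ?_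
  have hne : j' ≠ j := by
    rintro rfl
    exact hk (mem_filter.1 hj').2.symm
  rw [Function.update_of_ne hne]

/-- On the path the new value is obtained from the old one by the local rule
`B_k ↦ B_k − v_j² + c²` (one subtraction and one addition per path node).
[cite: KerenidisPrakash2017, §7 proof of Theorem 7.1 ("all the nodes on the path from that leaf to
the tree root are also updated")]; [cite: TangEwin2019, §3 Lemma 3.1 (first operation)] -/
theorem nodeWeight_update_path (v : Fin (2 ^ d) → ℝ) (j : Fin (2 ^ d)) (c : ℝ) (t : ℕ) :
    nodeWeight (Function.update v j c) t (prefixOf t j)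
      = nodeWeight v t (prefixOf t j) - v j ^ 2 + c ^ 2 := by
  unfold nodeWeight
  have hj : j ∈ univ.filter (fun j' : Fin (2 ^ d) => prefixOf t j' = prefixOf t j) := by simp
  rw [← add_sum_erase _ _ hj, ← add_sum_erase _ _ hj, Function.update_self]
  have hrest : ∑ x ∈ (univ.filter fun j' : Fin (2 ^ d) => prefixOf t j' = prefixOf t j).erase j,
      Function.update v j c x ^ 2
      = ∑ x ∈ (univ.filter fun j' : Fin (2 ^ d) => prefixOf t j' = prefixOf t j).erase j,
        v x ^ 2 := by
    refine sum_congr rfl fun x hx => ?_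
    rw [Function.update_of_ne (ne_of_mem_erase hx)]
  rw [hrest]
  ring

/-- The path `{(t, j_{1:t}) : t ≤ d}` — the only nodes an update of entry `j` can change — has
exactly `d + 1` elements. [cite: KerenidisPrakash2017, §7 proof of Theorem 7.1 ("the insertion
algorithm makes at most `⌈log n⌉` updates to the data structure")] -/
theorem card_path (j : Fin (2 ^ d)) :
    ((range (d + 1)).image fun t => (t, prefixOf t j)).card = d + 1 := by
  rw [card_image_of_injective _ fun t t' h => (Prod.mk.inj h).1, card_range]

/-! ### The matrix structure: one tree per row plus one for the row norms
(Tang Prop. 3.2 = KP Theorem 5.1 / A.1)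

> **Proposition 3.2 (Tang).** Consider a matrix `A ∈ ℝ^{m×n}`.  Let `Ã ∈ ℝ^m` be a vector whose
> `i`th entry is `‖A_i‖`.  There exists a data structure storing a matrix `A ∈ ℝ^{m×n}` with `w`
> nonzero entries in `O(w log mn)` space, supporting the following operations: reading and
> updating an entry of `A` in `O(log mn)` time; finding `Ã_i` in `O(log m)` time; finding `‖A‖_F²`
> in `O(1)` time; sampling from `𝒟_Ã` and `𝒟_{A_i}` in `O(log mn)` time.
>
> "This can be done by having a copy of the data structure specified by Lemma 3.1 for each row of
> `A` and `Ã` (which we can think of as the roots of the BSTs for `A`'s rows).  This has all of the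
> desired properties, and in fact, is the data structure Kerenidis and Prakash use to prepare
> arbitrary quantum states (Theorem A.1 in [KP17])."  (KP, Theorem 5.1: "There exists a data
> structure to store the entries of `A` with the following properties: … The time to store a new
> entry `(i,j,A_{ij})` is `O(log²(mn))`. A quantum algorithm that has quantum access to the data
> structure can perform the mapping `Ũ : |i⟩|0⟩ → |i⟩|A_i⟩`, for `i ∈ [m]`, … and the mapping
> `Ṽ : |0⟩|j⟩ → |Ã⟩|j⟩`, for `j ∈ [n]`, where `Ã ∈ ℝ^m` has entries `Ã_i = ‖A_i‖`".)

Here `m = 2^e`, `n = 2^d`; the row trees are `nodeWeight (A i)` and the row-norm tree is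
`nodeWeight (rowNormVec A)`.  Running times are again represented by the stored numbers and the
node counts (`card_path`: `d+1` nodes in a row tree, `e+1` in the row-norm tree per entry update). -/

section matrix

variable {e : ℕ}

/-- The vector of row norms `Ã`, `Ã_i = ‖A_i‖` — the leaves of the row-norm tree ("which we can
think of as the roots of the BSTs for `A`'s rows": `Ã_i²` is the root value of row `i`'s tree,
`rowNormVec_sq`). [cite: TangEwin2019, §3 Proposition 3.2 ("Let `Ã ∈ ℝ^m` be a vector whose
`i`th entry is `‖A_i‖`")]; [cite: KerenidisPrakash2017, §5.1 Theorem 5.1 ("`Ã ∈ ℝ^m` has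
entries `Ã_i = ‖A_i‖`")] -/
def rowNormVec (A : Matrix (Fin (2 ^ e)) (Fin (2 ^ d)) ℝ) : Fin (2 ^ e) → ℝ :=
  fun i => Real.sqrt (normSq (A i))

/-- **"Finding `Ã_i` in `O(log m)` time"**: `Ã_i²` is the number stored at the root of row `i`'s
tree (and at leaf `i` of the row-norm tree). [cite: TangEwin2019, §3 Proposition 3.2 (second
operation)]; [cite: KerenidisPrakash2017, §7 proof of Theorem 7.1 ("the value stored at the root
is `‖A_i‖²`")] -/
theorem rowNormVec_sq (A : Matrix (Fin (2 ^ e)) (Fin (2 ^ d)) ℝ) (i : Fin (2 ^ e)) :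
    rowNormVec A i ^ 2 = nodeWeight (A i) 0 0 := by
  rw [rowNormVec, Real.sq_sqrt (normSq_nonneg _), nodeWeight_root]

/-- **"Finding `‖A‖_F²` in `O(1)` time"**: the root of the row-norm tree stores
`‖Ã‖² = ∑_i ‖A_i‖² = ‖A‖_F²`. [cite: TangEwin2019, §3 Proposition 3.2 (third operation)];
[cite: KerenidisPrakash2017, §5.1 Theorem 5.1] -/
theorem nodeWeight_rowNormVec_root (A : Matrix (Fin (2 ^ e)) (Fin (2 ^ d)) ℝ) :
    nodeWeight (rowNormVec A) 0 0 = frobSq A := by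
  rw [nodeWeight_root, frobSq_eq_normSq_rowNorms]
  rfl

/-- `Ã = 0` iff `A = 0` (so the row-norm tree can be sampled exactly when `A ≠ 0`).
[cite: TangEwin2019, §3 Proposition 3.2] -/
theorem rowNormVec_eq_zero_iff (A : Matrix (Fin (2 ^ e)) (Fin (2 ^ d)) ℝ) :
    rowNormVec A = 0 ↔ A = 0 := by
  constructor
  · intro h
    ext i j
    have hi : Real.sqrt (normSq (A i)) = 0 := congrFun h i
    rw [Real.sqrt_eq_zero (normSq_nonneg _), normSq_eq_zero_iff] at hi
    simpa using congrFun hi j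
  · rintro rfl
    funext i
    simp [rowNormVec, normSq]

/-- **Sampling from `𝒟_Ã`** ("Sampling from `𝒟_Ã` … in `O(log mn)` time"): descending the row-norm
tree outputs row `i` with probability `‖A_i‖²/‖A‖_F²` = `rowDist A i` (`A ≠ 0`).
[cite: TangEwin2019, §3 Proposition 3.2 (fourth operation)]; [cite: KerenidisPrakash2017, §5.1
Theorem 5.1 (the mapping "`Ṽ : |0⟩|j⟩ → |Ã⟩|j⟩`")] -/
theorem leafProb_rowNormVec {A : Matrix (Fin (2 ^ e)) (Fin (2 ^ d)) ℝ} (hA : A ≠ 0)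
    (i : Fin (2 ^ e)) : leafProb (rowNormVec A) i = rowDist A i := by
  rw [leafProb_eq_lengthSqDist (mt (rowNormVec_eq_zero_iff A).1 hA), rowDist_eq_lengthSqDist]
  rfl

/-- **Sampling from `𝒟_{A_i}`**: descending row `i`'s tree outputs column `j` with probability
`A_{ij}²/‖A_i‖²` (`A_i ≠ 0`) — Lemma 3.1 for the row. [cite: TangEwin2019, §3 Proposition 3.2
(fourth operation)]; [cite: KerenidisPrakash2017, §5.1 Theorem 5.1 (the mapping
"`Ũ : |i⟩|0⟩ → |i⟩|A_i⟩`")] -/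
theorem leafProb_row {A : Matrix (Fin (2 ^ e)) (Fin (2 ^ d)) ℝ} {i : Fin (2 ^ e)} (hi : A i ≠ 0)
    (j : Fin (2 ^ d)) : leafProb (A i) j = lengthSqDist (A i) j :=
  leafProb_eq_lengthSqDist hi j

/-- **The two-stage sample**: row `i` from the row-norm tree, then column `j` from row `i`'s tree,
outputs `(i,j)` with probability `A_{ij}²/‖A‖_F²` (`A ≠ 0`; a zero row is never chosen, so the
junk value of its tree is irrelevant) — `ℓ²`-sampling access to `vec A`, the input of FKV /
ModFKV. [cite: TangEwin2019, §3 Proposition 3.2 and §4.2 (ModFKV "Sample rows `i_1,…,i_q` from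
`𝒟_Ã` … choosing a column from `𝒟_{A_{i_s}}`")]; [cite: KerenidisPrakash2017, §5.1 Theorem 5.1] -/
theorem leafProb_rowNormVec_mul_leafProb_row {A : Matrix (Fin (2 ^ e)) (Fin (2 ^ d)) ℝ}
    (hA : A ≠ 0) (i : Fin (2 ^ e)) (j : Fin (2 ^ d)) :
    leafProb (rowNormVec A) i * leafProb (A i) j = A i j ^ 2 / frobSq A := by
  rw [leafProb_rowNormVec hA]
  rcases eq_or_ne (A i) 0 with hi | hi
  · have hij : A i j = 0 := by simpa using congrFun hi j
    have h0 : rowDist A i = 0 := by simp [rowDist, hi, normSq]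
    simp [h0, hij]
  · rw [leafProb_row hi, rowDist_mul_lengthSqDist]

/-- A nonzero matrix has a positive root value `‖A‖_F²` in its row-norm tree.
[cite: TangEwin2019, §3 Proposition 3.2 (third operation)] -/
theorem frobSq_pos_of_ne_zero {A : Matrix (Fin (2 ^ e)) (Fin (2 ^ d)) ℝ} (hA : A ≠ 0) :
    0 < frobSq A := by
  rw [← nodeWeight_rowNormVec_root, nodeWeight_root]
  exact normSq_pos (mt (rowNormVec_eq_zero_iff A).1 hA)

/-- The two-stage leaf probabilities form a probability distribution on `[m] × [n]` (`A ≠ 0`).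
[cite: TangEwin2019, §3 Proposition 3.2] -/
theorem sum_leafProb_rowNormVec_mul_leafProb_row {A : Matrix (Fin (2 ^ e)) (Fin (2 ^ d)) ℝ}
    (hA : A ≠ 0) : ∑ i, ∑ j, leafProb (rowNormVec A) i * leafProb (A i) j = 1 := by
  simp_rw [leafProb_rowNormVec_mul_leafProb_row hA]
  have h := sum_rowDist_mul_lengthSqDist (frobSq_pos_of_ne_zero hA).ne'
  simp_rw [rowDist_mul_lengthSqDist] at h
  exact h

/-- **Updating an entry**: `A` with `A_{ij}` replaced by `c`. [cite: TangEwin2019, §3 Proposition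
3.2 (first operation: "Reading and updating an entry of `A` in `O(log mn)` time")] -/
def updateEntry (A : Matrix (Fin (2 ^ e)) (Fin (2 ^ d)) ℝ) (i : Fin (2 ^ e)) (j : Fin (2 ^ d))
    (c : ℝ) : Matrix (Fin (2 ^ e)) (Fin (2 ^ d)) ℝ :=
  Matrix.updateRow A i (Function.update (A i) j c)

/-- Rows other than `i` (hence their trees) are untouched by an update of `A_{ij}`.
[cite: TangEwin2019, §3 Proposition 3.2 (first operation)] -/
theorem updateEntry_row_of_ne (A : Matrix (Fin (2 ^ e)) (Fin (2 ^ d)) ℝ) {i i' : Fin (2 ^ e)}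
    (h : i' ≠ i) (j : Fin (2 ^ d)) (c : ℝ) : updateEntry A i j c i' = A i' := by
  simp [updateEntry, Matrix.updateRow_ne h]

/-- Row `i` becomes the updated vector, so its tree changes exactly as in Lemma 3.1
(`nodeWeight_update_of_ne`, `nodeWeight_update_path`: the `d+1` path nodes, by `−A_{ij}² + c²`).
[cite: TangEwin2019, §3 Proposition 3.2 (first operation)] -/
theorem updateEntry_row_self (A : Matrix (Fin (2 ^ e)) (Fin (2 ^ d)) ℝ) (i : Fin (2 ^ e))
    (j : Fin (2 ^ d)) (c : ℝ) : updateEntry A i j c i = Function.update (A i) j c := by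
  simp [updateEntry]

/-- The squared norm of the updated row: `‖A_i'‖² = ‖A_i‖² − A_{ij}² + c²` (the new root of row
`i`'s tree). [cite: TangEwin2019, §3 Proposition 3.2]; [cite: KerenidisPrakash2017, §7 proof of
Theorem 7.1] -/
theorem normSq_update_row (A : Matrix (Fin (2 ^ e)) (Fin (2 ^ d)) ℝ) (i : Fin (2 ^ e))
    (j : Fin (2 ^ d)) (c : ℝ) :
    normSq (Function.update (A i) j c) = normSq (A i) - A i j ^ 2 + c ^ 2 := by
  have h := nodeWeight_update_path (A i) j c 0
  rwa [prefixOf_zero, nodeWeight_root, nodeWeight_root] at h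

/-- **The row-norm tree sees a vector update**: after `A_{ij} ↦ c` the vector `Ã` changes only in
coordinate `i`, to `√(‖A_i‖² − A_{ij}² + c²)` — so the row-norm tree is updated along ONE
root-to-leaf path as well (`e+1` nodes), for a total of `(d+1)+(e+1) = log₂(mn) + 2` touched
nodes. [cite: TangEwin2019, §3 Proposition 3.2 (first operation, `O(log mn)`)];
[cite: KerenidisPrakash2017, §5.1 Theorem 5.1 ("The time to store a new entry `(i,j,A_{ij})` is
`O(log²(mn))`" — their cost model charges `O(log mn)` per node address, §7 proof of Theorem 7.1)] -/
theorem rowNormVec_updateEntry (A : Matrix (Fin (2 ^ e)) (Fin (2 ^ d)) ℝ) (i : Fin (2 ^ e))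
    (j : Fin (2 ^ d)) (c : ℝ) :
    rowNormVec (updateEntry A i j c) =
      Function.update (rowNormVec A) i (Real.sqrt (normSq (A i) - A i j ^ 2 + c ^ 2)) := by
  funext i'
  rcases eq_or_ne i' i with rfl | h
  · rw [Function.update_self, rowNormVec, updateEntry_row_self, normSq_update_row]
  · rw [Function.update_of_ne h, rowNormVec, rowNormVec, updateEntry_row_of_ne A h]

/-- Off the root-to-`i` path the row-norm tree is unchanged by the update of `A_{ij}`.
[cite: TangEwin2019, §3 Proposition 3.2 (first operation)] -/
theorem nodeWeight_rowNormVec_updateEntry_of_ne (A : Matrix (Fin (2 ^ e)) (Fin (2 ^ d)) ℝ)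
    (i : Fin (2 ^ e)) (j : Fin (2 ^ d)) (c : ℝ) {t k : ℕ} (hk : k ≠ prefixOf t i) :
    nodeWeight (rowNormVec (updateEntry A i j c)) t k = nodeWeight (rowNormVec A) t k := by
  rw [rowNormVec_updateEntry, nodeWeight_update_of_ne _ _ _ hk]

/-- On the root-to-`i` path of the row-norm tree every node changes by the same local rule as in
row `i`'s tree: `B ↦ B − A_{ij}² + c²`. [cite: TangEwin2019, §3 Proposition 3.2 (first
operation)]; [cite: KerenidisPrakash2017, §7 proof of Theorem 7.1] -/
theorem nodeWeight_rowNormVec_updateEntry_path (A : Matrix (Fin (2 ^ e)) (Fin (2 ^ d)) ℝ)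
    (i : Fin (2 ^ e)) (j : Fin (2 ^ d)) (c : ℝ) (t : ℕ) :
    nodeWeight (rowNormVec (updateEntry A i j c)) t (prefixOf t i)
      = nodeWeight (rowNormVec A) t (prefixOf t i) - A i j ^ 2 + c ^ 2 := by
  have hnn : 0 ≤ normSq (A i) - A i j ^ 2 + c ^ 2 := by
    have := sq_le_normSq (A i) j
    nlinarith [sq_nonneg c]
  rw [rowNormVec_updateEntry, nodeWeight_update_path, Real.sq_sqrt hnn, rowNormVec,
    Real.sq_sqrt (normSq_nonneg _)]
  ring

end matrix

end KPTree

end SampleQuery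

end Literature.Computability.QuantumComplexity

end
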